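import Summits.QuantumFields.BalabanUV.T4Continuum.Support.NE9CurChartTowerPiLipschitzAtFlatLatticeUniformClassW80
import Summits.QuantumFields.BalabanUV.T4Continuum.Support.NE9CurChartTowerPiLatticeUniformFlatWitness

/-!
# NE9CurChartTowerPiLipschitzAtFlatLatticeUniformClassW80TopLevel — (TOP-LEVEL (115) PROFILE `lev ≡ n+1`, `ω = Ω = 1`) THE `k`-LEVEL `cur U` CHART WITH THE GENUINE
# (L3) SLOT `W80` IS LIPSCHITZ IN THE BACKGROUND AT THE FLAT POINT FOR EVERY BACKGROUND OF PRINT's UNITARY SMALL-FIELD CLASS, EVERY LATTICE OF THE TOWER — NOTHING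
# DISPLAYED BUT THE CLASS, THE DIAGONAL BOOKKEEPING AND THE (HEIGHT-FREE) NUMERICS; the sibling `NE9CurChartTowerPiLipschitzAtFlatLatticeUniformClassW80` (this seat,
# gen 106) read at the constant level maps `n+1` (`NE9CurChartTowerPiLatticeUniformFlatWitness.topLevel_weights` ∕ `zeroExp_weights`), pattern of gen 98's
# `NE9CurChartTowerPiLatticeUniformClassW80VJDeltaTopLevel`; cell `pub-balaban`, T4-DAG §2 node U3 ∕ §6 NE9, WALL-NE9-P1 §3 (ii)∕(vii); NE9 crux-team (2) LEAF PROVER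
# 01 (`b2b-balaban-t4-ne9-formalise-leaf-01`, gen 106); bears_on R4/N22; nothing printed asserted

HONEST FRAMING (T4-DAG PAGE 1).  Rung (B)+1 of the FINITE-VOLUME T⁴ programme — NOT infinite volume, NOT a mass gap, NOT the Clay problem.  NE9 is a cell NEW
ESTIMATE, NOT PRINTED in [Balaban1987RG1] ∕ [Balaban1988RG2Cluster], NOT PROVED here («NE9 ⇐ the named binders»; spine PROVED 0∕9).  HONEST DEPENDENCY (cell
line, verbatim): continuum YM on T⁴ ⇐ BetaPertH ∧ nine spine estimates (0/9 proved); BetaPertH ⇐ (D1) ∧ (D4) ∧ CAP+tail; G-an2-4 gates asym, D1 and NE2/3/4.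
WHAT THIS FILE PROVES (ONE theorem; 0 def, 0 sorry; composition BY NAME).  **`cur_chart_tower_pi_lipschitz_at_flat_of_unitary_class_topLevel_W80`**: the sibling at
`ω = Ω = 1`, `lev₀ = lev₁ ≡ n+1`, ANY `levB` (exponent `0`): `∃ α₁ j₁ ε₄ ε_C R_b K > 0` BEFORE `∀ n η m U` — the ∀-block is print's class (`Ũ ∈ unitaryUnits`, the bond,
all-direction, plaquette and gradient windows at `α ≤ α₁`, the current window `‖J‖ ≤ j₀ ≤ j₁`), the diagonal bookkeeping and `levB` ONLY; `∃ h52 hpos′ hposπ hpos₁` PRODUCED;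
for every `‖B‖ < R_b`: `‖ι(chartHB 𝔊̃_k(U) 0 W80(U) 0 T_U ε₄ H̃_{1,k}(U) B) − chartHB 𝔊_k(1) 0 W80(1) 0 T_1 ε₄ H_{1,k}(1) B‖ ≤ K·(j₀ + α)`.
DISGUISE TEST: one application of the sibling; no inequality of the series proved HERE; constants crude; `j₀`, `α` displayed separately; NOT the gauge step of p. 416,
NOT a general two-background pair, NOT claimed that Bałaban's 𝐇_k ∕ U_j(□₀, exp iB) meet these letters (O-NE9-1; #5 UNRULED); not NE9.
References (TYPES ∕ loci only): [Balaban1985Variational] (27)–(28) p. 282, (47) p. 285, Prop. 4 (97)–(98) p. 293, (115) p. 294, Prop. 6 (116)–(121) p. 295,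
(174)–(175) p. 305; [Balaban1985BackgroundPropagators] (3.35)–(3.37) p. 396, (3.122)–(3.126) p. 420, (3.153) p. 426, Thm 3.13 p. 426; [Balaban1985Averaging]
Prop. 2 (52)–(54) p. 26, Prop. 5 p. 42, Proposition 7 p. 43.
-/

noncomputable section

open Metric Set

namespace Summit.QuantumFields.BalabanUV.T4Continuum.NE9CurChartTowerPiLipschitzAtFlatLatticeUniformClassW80TopLevel

open scoped InnerProductSpace ComplexConjugate BigOperators
open Literature.MathematicalPhysics.QuantumFieldTheory.Balaban1983to89
open B11Eq103H1Complex B11Eq115Space B11Eq174Chart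
open B11Eq111FrakG (nabla115 jetLinearEquiv)  open B9SectCLatticeCarrier (Bond bpos btgt shift unshift)  open B4Sect5Torus (TSite)
open B7Prop1Explicit (U1 Wcx boxVec)  open B7Prop2Explicit (pdev AvgClosed C0 c2' unitaryUnits avgClosed_unitaryUnits unitaryUnits_le_U1)
open B7Prop3Flat (c3)  open B7Prop5GeneralLevels (thetaGen C3Gen)  open B7Prop5CplxLevels (epsCplx tauCplx C3Cplx)
open B9Eq315QTorus (perCfg cornerSite)  open B9Eq315QTower (towerP UlevOf)
open B9Eq315QTowerFlat (perCfg_UlevOf_one_mem_U1 norm_Wcx_UlevOf_one_sub_one_le QkW_one_surjective)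
open B9Eq326OperatorTower (QkW QkW_surjective laplaceAk RofUk)  open B9Eq310HessianOperator (adTransportW hessOp)
open B9Eq310DeltaPrime (plaqHolU)  open B9Eq324DeltaPrimeATower (laplacePrimeAk)  open B9Eq3119DeltaPiTower (laplaceAkPi)
open B11Eq44COperatorTower (αT αT_le ulev_mem_U1_of_pdev)  open B11Eq44COperatorTowerGeometric (ulev_reg_of_pdev_geometric geomProfile_le_αT)
open B11Eq44CLetterTower (Cck)  open B9Eq3119DeltaPiCarrier (currentCLM)
open B11Eq98V0primeCurrentSlots (rieszτ)  open B11Eq98CurrentSlot (Jcur)  open B11Eq80Current (W80)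
open Summit.QuantumFields.BalabanUV.T4Continuum.NE9CurChartTowerPiLipschitzAtFlatLatticeUniformClassW80
  (cur_chart_tower_pi_lipschitz_at_flat_of_unitary_class_lattice_uniform_W80)
open Summit.QuantumFields.BalabanUV.T4Continuum.NE9CurChartTowerPiLatticeUniformFlatWitness (topLevel_weights zeroExp_weights)

variable {d : ℕ} (hd : 1 ≤ d) (L : ℕ) [NeZero L] (hL : 1 ≤ L) (hL2 : 2 ≤ L) (hL3 : 3 ≤ L) [Fact (0 < (L : ℝ))]
  {𝔸 : Type*} [CStarAlgebra 𝔸] [Nontrivial 𝔸] [FiniteDimensional ℂ 𝔸]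
  {W : Type*} [NormedAddCommGroup W] [InnerProductSpace ℂ W] [FiniteDimensional ℂ W] (φ : W ≃ₗ[ℂ] 𝔸)
  {Mφ Mφ' : ℝ} (hMφ : 0 ≤ Mφ) (hMφ' : 0 ≤ Mφ') (hφ : ∀ w, ‖φ w‖ ≤ Mφ * ‖w‖) (hφ' : ∀ X, ‖φ.symm X‖ ≤ Mφ' * ‖X‖)
  {a : ℝ} (ha : 0 < a) {a' : ℝ} (ha' : 0 < a')
  (τ : 𝔸 →ₗ[ℂ] ℂ) {Cτ : ℝ} (hτ : ∀ X, ‖τ X‖ ≤ Cτ * ‖X‖) (hCτ : 0 ≤ Cτ) {Mτ : ℝ} (hτm : ∀ X Y : 𝔸, ‖τ (X * Y)‖ ≤ Mτ * ‖X‖ * ‖Y‖) (hMτ : 0 ≤ Mτ)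
  {ρw : ℝ} (hρw : 0 ≤ ρw)
  (hτ₁ : ∀ X : 𝔸, τ (star X) = conj (τ X)) (hτ₂ : ∀ X Y : 𝔸, τ (X * Y) = τ (Y * X)) (hφτ : ∀ X Y : 𝔸, ⟪φ.symm X, φ.symm Y⟫_ℂ = τ (star X * Y))
  {α₀ : ℝ} (hα₀ : 0 < α₀) (hα3 : C0 d * α₀ ≤ 1 / 3) (hα4 : 4 * α₀ ≤ c2' d L) (hα8 : 8 * α₀ ≤ c2' d L)
  (hαL : 50 * (d + 1) * αT d L α₀ * (L : ℝ) ^ d ≤ 1 / 2)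
  {ρ : ℝ} (hρ0 : 0 < ρ) (hρ : Real.exp (4 * (800 * ((d : ℝ) + 1) ^ 2 * ((d : ℝ) + 4)) * α₀) * (1 + 8 * (131072 * ((d : ℝ) + 1) ^ 2) * ρ) ≤ 2)
  (hρ4 : 4 * ρ ≤ c3 d L) (hθ : 2 * d * thetaGen d L α₀ ≤ (L : ℝ) ^ 3 / 16) (hC3 : 2 * d * C3Gen d L * ρ ≤ 1)
  (hCτ1 : Cτ ≤ 1)
  {r' : ℝ} (hr' : 0 < r')
  (h7s' : Real.exp (4 * (800 * ((d : ℝ) + 1) ^ 2 * ((d : ℝ) + 4)) * α₀) * (1 + 8 * (131072 * ((d : ℝ) + 1) ^ 2) * r') ≤ 2)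
  (h7c' : 2 * r' ≤ c3 d L) (h7r'1 : 409600 * ((d : ℝ) + 1) ^ 2 * r' ≤ 1)
  (h7s : Real.exp (4480 * ((d : ℝ) + 1) ^ 2 * ((d : ℝ) + 4) * α₀ + 240000 * ((d : ℝ) + 1) ^ 3 * r') * (1 + 8 * (2097152 * ((d : ℝ) + 1) ^ 2) * ρ) ≤ 2)
  (h7c : 16 * ρ < c3 d L) (h7β : (d : ℝ) * C3Cplx d L * ρ ≤ 1)
  (h7E : epsCplx d L r' 0 ≤ 1 / 16) (h7dX : (d : ℝ) * (epsCplx d L r' 0 + tauCplx d L α₀ 0 r' 0) ≤ 1 / 16)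

-- deep definitional unfolding `laplaceAkPi` ↦ `laplaceALatticeK … (π†Δπ) …` in the statement (as the host)
set_option maxRecDepth 8192 in
set_option maxHeartbeats 6400000 in -- the sibling's ≈ 40-binder theorem applied once
include hd hL2 hL3 hMφ hMφ' hφ hφ' ha ha' hτ hCτ hτm hMτ hρw hτ₁ hτ₂ hφτ hα₀ hα3 hα4 hα8 hαL hρ0 hρ hρ4 hθ hC3 hCτ1 hr' h7s' h7c' h7r'1 h7s h7c h7β h7E h7dX in
/-- **THE `k`-LEVEL `cur U` CHART WITH THE GENUINE SLOT, LIPSCHITZ AT THE FLAT POINT FOR EVERY BACKGROUND OF PRINT's CLASS AND EVERY LATTICE — NOTHING ELSE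
DISPLAYED**: the sibling at `ω = Ω = 1` and the constant level maps `n+1` (`topLevel_weights`, `zeroExp_weights`). [folklore]
[cite: Balaban1985Variational, Prop. 4 (97)–(98) p.293, (115) p.294, Prop. 6 (116)–(121) p.295, (174)–(175) p.305, (47) p.285; Balaban1985BackgroundPropagators, (3.35)–(3.37) p.396, (3.122) p.420, (3.126) p.420, (3.153) p.426, Thm 3.13 p.426; Balaban1985Averaging, Prop. 2 (52)–(54) p.26, Prop. 5 p.42, Proposition 7 p.43] -/
theorem cur_chart_tower_pi_lipschitz_at_flat_of_unitary_class_topLevel_W80 :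
    ∃ α₁ j₁ ε₄ εC Rb K : ℝ, 0 < α₁ ∧ 0 < j₁ ∧ 0 < ε₄ ∧ 0 < εC ∧ 0 < Rb ∧ 0 < K ∧
      ∀ (n : ℕ) (η : ℝ) [Fact (0 < η)] (hηL : η * (L : ℝ) ^ (n + 1) = 1) (c₀ c₁ : ℝ) [Fact (0 < c₀)] [Fact (0 < c₁)]
        (_hw : c₀ * ((L : ℝ) ^ (n + 1)) ^ d = c₁) (_hc₀η : c₀ = η ^ d) (_hρ : |η| ^ d / c₀ ≤ ρw) (m : Fin d → ℕ) [∀ i, NeZero (m i)] (_hm : ∀ i, 1 ≤ m i)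
        (U : Bond d (towerP L m (n + 1)) → 𝔸ˣ) (hUG : ∀ (x : B7Prop1Explicit.Site d) (κ : Fin d), perCfg (towerP L m (n + 1)) U x κ ∈ unitaryUnits 𝔸)
        (α : ℝ) (_hα : 0 ≤ α) (_hαle : α ≤ α₁) (_hUη : ∀ b, ‖(U b : 𝔸) - 1‖ ≤ α * η)
        (_hUw : ∀ (x : TSite d (towerP L m (n + 1))) (μ ν : Fin d), ‖(U (shift ν x, μ) : 𝔸) - (U (x, μ) : 𝔸)‖ ≤ α * η ^ 2)
        (_hpl : ∀ p : B9SectCLatticeCarrier.Plaq d (towerP L m (n + 1)), ‖(plaqHolU U p : 𝔸) - 1‖ ≤ α * η ^ 2)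
        (_hUgrad : ∀ (x : TSite d (towerP L m (n + 1))) (μ : Fin d), ‖(U (x, μ) : 𝔸) - U (unshift μ x, μ)‖ ≤ α * η ^ 2)
        (j₀ : ℝ) (_hJ : ∀ μ y, ‖B9Eq39Adjoint.J (fun μ => B9Eq33CovDerivVector.shiftEquiv μ) (fun μ y => U (y, μ)) η μ y‖ ≤ j₀) (_hj : j₀ ≤ j₁)
        (levB : Bond d m → ℕ),
      ∃ h52 : pdev (perCfg (towerP L m (n + 1)) U) < α₀ * (((L : ℝ) ^ (n + 1))⁻¹) ^ 2,
      ∃ hpos' : ∀ x : SiteL2K ℂ d (towerP L m (n + 1)) c₀ W, x ≠ 0 →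
          0 < RCLike.re ⟪x, laplacePrimeAk L m n φ η U a' (c₁ := c₁) x⟫_ℂ,
      ∃ hposπ : ∀ x : BondL2K ℂ d (towerP L m (n + 1)) c₀ W, x ≠ 0 →
          0 < RCLike.re ⟪x, laplaceAkPi L m n φ τ η U a' hpos' hL (fun j => αT d L α₀ * (((L : ℝ) ^ min (j + 1) (n + 1))⁻¹) ^ 2)
            (fun j => (geomProfile_le_αT (d := d) L (n + 1) hL hα₀.le j).trans (αT_le hL hα4))
            (ulev_mem_U1_of_pdev L m (n + 1) U hL2 (avgClosed_unitaryUnits d L) hUG hα₀ hα3 hα4 h52)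
            (ulev_reg_of_pdev_geometric L m (n + 1) U hL2 (avgClosed_unitaryUnits d L) hUG hα₀ hα3 hα4 h52) (c₁ := c₁) a x⟫_ℂ,
      ∃ hpos₁ : ∀ x : BondL2K ℂ d (towerP L m (n + 1)) c₀ W, x ≠ 0 →
          0 < RCLike.re ⟪x, laplaceAk L m n φ η (fun _ : Bond d (towerP L m (n + 1)) => (1 : 𝔸ˣ)) hL (fun _ => 0) (fun _ => by norm_num)
            (perCfg_UlevOf_one_mem_U1 L m (n + 1)) (norm_Wcx_UlevOf_one_sub_one_le L m (n + 1) (fun _ => 0) (fun _ => le_rfl)) τ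
            (c₀ := c₀) (c₁ := c₁) a x⟫_ℂ,
      ∀ (B : NegSize (L : ℝ) η levB 0 𝔸), ‖B‖ < Rb →
        ‖LinearMap.toContinuousLinearMap
              ((jetLinearEquiv (L : ℝ) η (fun _ : Bond d (towerP L m (n + 1)) => n + 1) (fun _ : Bond d (towerP L m (n + 1)) × Fin d => n + 1) (nabla115 η (fun _ : Bond d (towerP L m (n + 1)) => (1 : 𝔸ˣ)))).symm.toLinearMap ∘ₗ
                (jetLinearEquiv (L : ℝ) η (fun _ : Bond d (towerP L m (n + 1)) => n + 1) (fun _ : Bond d (towerP L m (n + 1)) × Fin d => n + 1) (nabla115 η U)).toLinearMap) (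
            chartHB (frakGLatticeCLM (lev₀ := (fun _ : Bond d (towerP L m (n + 1)) => n + 1)) φ hposπ
                  (QkW_surjective L m n φ U hL _ _ _ _ fun j => le_trans (mul_le_mul_of_nonneg_right (mul_le_mul_of_nonneg_left
                    (geomProfile_le_αT (d := d) L (n + 1) hL hα₀.le j) (by positivity)) (by positivity)) hαL) (fun _ : Bond d (towerP L m (n + 1)) × Fin d => n + 1) (nabla115 η U))
                0 (W80 (rieszτ φ) (LinearMap.toContinuousLinearMap τ) U (H1LatticeCLM (lev₀ := (fun _ : Bond d (towerP L m (n + 1)) => n + 1)) (levB := levB) φ hposπ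
                  (QkW_surjective L m n φ U hL _ _ _ _ fun j => le_trans (mul_le_mul_of_nonneg_right (mul_le_mul_of_nonneg_left
                    (geomProfile_le_αT (d := d) L (n + 1) hL hα₀.le j) (by positivity)) (by positivity)) hαL) (fun _ : Bond d (towerP L m (n + 1)) × Fin d => n + 1) (nabla115 η U))
                  (Cck L m η (n + 1) U (fun _ : Bond d (towerP L m (n + 1)) => n + 1) (fun _ : Bond d (towerP L m (n + 1)) × Fin d => n + 1) (nabla115 η U) levB) εC (Jcur (L := (L : ℝ)) (η := η) (lev₀ := (fun _ : Bond d (towerP L m (n + 1)) => n + 1)) U)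
                  (currentCLM φ (fun _ : Bond d (towerP L m (n + 1)) × Fin d => n + 1) (nabla115 η U)
                    (laplaceAkPi L m n φ τ η U a' hpos' hL (fun j => αT d L α₀ * (((L : ℝ) ^ min (j + 1) (n + 1))⁻¹) ^ 2)
                        (fun j => (geomProfile_le_αT (d := d) L (n + 1) hL hα₀.le j).trans (αT_le hL hα4))
                        (ulev_mem_U1_of_pdev L m (n + 1) U hL2 (avgClosed_unitaryUnits d L) hUG hα₀ hα3 hα4 h52)
                        (ulev_reg_of_pdev_geometric L m (n + 1) U hL2 (avgClosed_unitaryUnits d L) hUG hα₀ hα3 hα4 h52) (c₁ := c₁) a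
                      - LinearMap.adjoint (QkW L m n φ U hL (fun j => αT d L α₀ * (((L : ℝ) ^ min (j + 1) (n + 1))⁻¹) ^ 2)
                        (fun j => (geomProfile_le_αT (d := d) L (n + 1) hL hα₀.le j).trans (αT_le hL hα4))
                        (ulev_mem_U1_of_pdev L m (n + 1) U hL2 (avgClosed_unitaryUnits d L) hUG hα₀ hα3 hα4 h52)
                        (ulev_reg_of_pdev_geometric L m (n + 1) U hL2 (avgClosed_unitaryUnits d L) hUG hα₀ hα3 hα4 h52) (c₀ := c₀) (c₁ := c₁)) ∘ₗ
                          ((a : ℂ) • QkW L m n φ U hL (fun j => αT d L α₀ * (((L : ℝ) ^ min (j + 1) (n + 1))⁻¹) ^ 2)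
                        (fun j => (geomProfile_le_αT (d := d) L (n + 1) hL hα₀.le j).trans (αT_le hL hα4))
                        (ulev_mem_U1_of_pdev L m (n + 1) U hL2 (avgClosed_unitaryUnits d L) hUG hα₀ hα3 hα4 h52)
                        (ulev_reg_of_pdev_geometric L m (n + 1) U hL2 (avgClosed_unitaryUnits d L) hUG hα₀ hα3 hα4 h52) (c₀ := c₀) (c₁ := c₁))))) 0 (fun A' => A' + solA (H1LatticeCLM (lev₀ := (fun _ : Bond d (towerP L m (n + 1)) => n + 1)) (levB := levB) φ hposπ
                  (QkW_surjective L m n φ U hL _ _ _ _ fun j => le_trans (mul_le_mul_of_nonneg_right (mul_le_mul_of_nonneg_left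
                    (geomProfile_le_αT (d := d) L (n + 1) hL hα₀.le j) (by positivity)) (by positivity)) hαL) (fun _ : Bond d (towerP L m (n + 1)) × Fin d => n + 1) (nabla115 η U)) 0
                  (Cck L m η (n + 1) U (fun _ : Bond d (towerP L m (n + 1)) => n + 1) (fun _ : Bond d (towerP L m (n + 1)) × Fin d => n + 1) (nabla115 η U) levB) 0 εC A') ε₄
                (H1LatticeCLM (lev₀ := (fun _ : Bond d (towerP L m (n + 1)) => n + 1)) (levB := levB) φ hposπ
                  (QkW_surjective L m n φ U hL _ _ _ _ fun j => le_trans (mul_le_mul_of_nonneg_right (mul_le_mul_of_nonneg_left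
                    (geomProfile_le_αT (d := d) L (n + 1) hL hα₀.le j) (by positivity)) (by positivity)) hαL) (fun _ : Bond d (towerP L m (n + 1)) × Fin d => n + 1) (nabla115 η U)) B) -
          chartHB (frakGLatticeCLM (L := (L : ℝ)) (η := η) (lev₀ := (fun _ : Bond d (towerP L m (n + 1)) => n + 1)) (c := ((η : ℂ))⁻¹)
              (R := adTransportW φ (fun _ : Bond d (towerP L m (n + 1)) => (1 : 𝔸ˣ)))
              (S := adTransportW φ fun _ : Bond d (towerP L m (n + 1)) => (1 : 𝔸ˣ)⁻¹) (Δ₁ := hessOp φ η (fun _ : Bond d (towerP L m (n + 1)) => (1 : 𝔸ˣ)) τ)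
              (Rr := RofUk L m n φ η (fun _ : Bond d (towerP L m (n + 1)) => (1 : 𝔸ˣ)))
              (Q := (QkW L m n φ (fun _ : Bond d (towerP L m (n + 1)) => (1 : 𝔸ˣ)) hL (fun _ => 0) (fun _ => by norm_num)
                (perCfg_UlevOf_one_mem_U1 L m (n + 1)) (norm_Wcx_UlevOf_one_sub_one_le L m (n + 1) (fun _ => 0) (fun _ => le_rfl)) (c₀ := c₀) (c₁ := c₁))) (a := a)
              φ hpos₁ (QkW_one_surjective L m hL n φ) (fun _ : Bond d (towerP L m (n + 1)) × Fin d => n + 1) (nabla115 η (fun _ : Bond d (towerP L m (n + 1)) => (1 : 𝔸ˣ)))) 0 (W80 (rieszτ φ) (LinearMap.toContinuousLinearMap τ) (fun _ : Bond d (towerP L m (n + 1)) => (1 : 𝔸ˣ))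
              (H1LatticeCLM (L := (L : ℝ)) (η := η) (lev₀ := (fun _ : Bond d (towerP L m (n + 1)) => n + 1)) (levB := levB) (c := ((η : ℂ))⁻¹)
              (R := adTransportW φ (fun _ : Bond d (towerP L m (n + 1)) => (1 : 𝔸ˣ)))
              (S := adTransportW φ fun _ : Bond d (towerP L m (n + 1)) => (1 : 𝔸ˣ)⁻¹) (Δ₁ := hessOp φ η (fun _ : Bond d (towerP L m (n + 1)) => (1 : 𝔸ˣ)) τ)
              (Rr := RofUk L m n φ η (fun _ : Bond d (towerP L m (n + 1)) => (1 : 𝔸ˣ)))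
              (Q := (QkW L m n φ (fun _ : Bond d (towerP L m (n + 1)) => (1 : 𝔸ˣ)) hL (fun _ => 0) (fun _ => by norm_num)
                (perCfg_UlevOf_one_mem_U1 L m (n + 1)) (norm_Wcx_UlevOf_one_sub_one_le L m (n + 1) (fun _ => 0) (fun _ => le_rfl)) (c₀ := c₀) (c₁ := c₁))) (a := a)
              φ hpos₁ (QkW_one_surjective L m hL n φ) (fun _ : Bond d (towerP L m (n + 1)) × Fin d => n + 1) (nabla115 η (fun _ : Bond d (towerP L m (n + 1)) => (1 : 𝔸ˣ))))
              (Cck L m η (n + 1) (fun _ : Bond d (towerP L m (n + 1)) => (1 : 𝔸ˣ)) (fun _ : Bond d (towerP L m (n + 1)) => n + 1) (fun _ : Bond d (towerP L m (n + 1)) × Fin d => n + 1) (nabla115 η (fun _ : Bond d (towerP L m (n + 1)) => (1 : 𝔸ˣ))) levB) εC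
              (Jcur (L := (L : ℝ)) (η := η) (lev₀ := (fun _ : Bond d (towerP L m (n + 1)) => n + 1)) (fun _ : Bond d (towerP L m (n + 1)) => (1 : 𝔸ˣ)))
              (currentCLM φ (fun _ : Bond d (towerP L m (n + 1)) × Fin d => n + 1) (nabla115 η (fun _ : Bond d (towerP L m (n + 1)) => (1 : 𝔸ˣ)))
                (laplaceAk L m n φ η (fun _ : Bond d (towerP L m (n + 1)) => (1 : 𝔸ˣ)) hL (fun _ => 0) (fun _ => by norm_num)
                    (perCfg_UlevOf_one_mem_U1 L m (n + 1)) (norm_Wcx_UlevOf_one_sub_one_le L m (n + 1) (fun _ => 0) (fun _ => le_rfl)) τ (c₀ := c₀) (c₁ := c₁) a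
                  - LinearMap.adjoint (QkW L m n φ (fun _ : Bond d (towerP L m (n + 1)) => (1 : 𝔸ˣ)) hL (fun _ => 0) (fun _ => by norm_num)
                      (perCfg_UlevOf_one_mem_U1 L m (n + 1)) (norm_Wcx_UlevOf_one_sub_one_le L m (n + 1) (fun _ => 0) (fun _ => le_rfl)) (c₀ := c₀) (c₁ := c₁)) ∘ₗ
                      ((a : ℂ) • (QkW L m n φ (fun _ : Bond d (towerP L m (n + 1)) => (1 : 𝔸ˣ)) hL (fun _ => 0) (fun _ => by norm_num)
                        (perCfg_UlevOf_one_mem_U1 L m (n + 1)) (norm_Wcx_UlevOf_one_sub_one_le L m (n + 1) (fun _ => 0) (fun _ => le_rfl)) (c₀ := c₀) (c₁ := c₁)))))) 0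
            (fun A' => A' + solA (H1LatticeCLM (L := (L : ℝ)) (η := η) (lev₀ := (fun _ : Bond d (towerP L m (n + 1)) => n + 1)) (levB := levB) (c := ((η : ℂ))⁻¹)
              (R := adTransportW φ (fun _ : Bond d (towerP L m (n + 1)) => (1 : 𝔸ˣ)))
              (S := adTransportW φ fun _ : Bond d (towerP L m (n + 1)) => (1 : 𝔸ˣ)⁻¹) (Δ₁ := hessOp φ η (fun _ : Bond d (towerP L m (n + 1)) => (1 : 𝔸ˣ)) τ)
              (Rr := RofUk L m n φ η (fun _ : Bond d (towerP L m (n + 1)) => (1 : 𝔸ˣ)))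
              (Q := (QkW L m n φ (fun _ : Bond d (towerP L m (n + 1)) => (1 : 𝔸ˣ)) hL (fun _ => 0) (fun _ => by norm_num)
                (perCfg_UlevOf_one_mem_U1 L m (n + 1)) (norm_Wcx_UlevOf_one_sub_one_le L m (n + 1) (fun _ => 0) (fun _ => le_rfl)) (c₀ := c₀) (c₁ := c₁))) (a := a)
              φ hpos₁ (QkW_one_surjective L m hL n φ) (fun _ : Bond d (towerP L m (n + 1)) × Fin d => n + 1) (nabla115 η (fun _ : Bond d (towerP L m (n + 1)) => (1 : 𝔸ˣ)))) 0
              (Cck L m η (n + 1) (fun _ : Bond d (towerP L m (n + 1)) => (1 : 𝔸ˣ)) (fun _ : Bond d (towerP L m (n + 1)) => n + 1) (fun _ : Bond d (towerP L m (n + 1)) × Fin d => n + 1) (nabla115 η (fun _ : Bond d (towerP L m (n + 1)) => (1 : 𝔸ˣ))) levB) 0 εC A') ε₄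
            (H1LatticeCLM (L := (L : ℝ)) (η := η) (lev₀ := (fun _ : Bond d (towerP L m (n + 1)) => n + 1)) (levB := levB) (c := ((η : ℂ))⁻¹)
              (R := adTransportW φ (fun _ : Bond d (towerP L m (n + 1)) => (1 : 𝔸ˣ)))
              (S := adTransportW φ fun _ : Bond d (towerP L m (n + 1)) => (1 : 𝔸ˣ)⁻¹) (Δ₁ := hessOp φ η (fun _ : Bond d (towerP L m (n + 1)) => (1 : 𝔸ˣ)) τ)
              (Rr := RofUk L m n φ η (fun _ : Bond d (towerP L m (n + 1)) => (1 : 𝔸ˣ)))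
              (Q := (QkW L m n φ (fun _ : Bond d (towerP L m (n + 1)) => (1 : 𝔸ˣ)) hL (fun _ => 0) (fun _ => by norm_num)
                (perCfg_UlevOf_one_mem_U1 L m (n + 1)) (norm_Wcx_UlevOf_one_sub_one_le L m (n + 1) (fun _ => 0) (fun _ => le_rfl)) (c₀ := c₀) (c₁ := c₁))) (a := a)
              φ hpos₁ (QkW_one_surjective L m hL n φ) (fun _ : Bond d (towerP L m (n + 1)) × Fin d => n + 1) (nabla115 η (fun _ : Bond d (towerP L m (n + 1)) => (1 : 𝔸ˣ)))) B‖ ≤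
          K * (j₀ + α) := by
  obtain ⟨α₁, j₁, ε₄, εC, Rb, K, hα₁, hj₁, hε₄, hεC, hRb, hK, HC⟩ :=
    cur_chart_tower_pi_lipschitz_at_flat_of_unitary_class_lattice_uniform_W80 hd L hL hL2 hL3 φ hMφ hMφ' hφ hφ' ha ha' τ hτ hCτ hτm hMτ hρw hτ₁ hτ₂ hφτ hα₀ hα3
      hα4 hα8 hαL hρ0 hρ hρ4 hθ hC3 hCτ1 (le_refl (1 : ℝ)) (le_refl (1 : ℝ)) hr' h7s' h7c' h7r'1 h7s h7c h7β h7E h7dX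
  refine ⟨α₁, j₁, ε₄, εC, Rb, K, hα₁, hj₁, hε₄, hεC, hRb, hK, ?_⟩
  intro n η _ hηL c₀ c₁ _ _ hw hc₀η hρ' m _ hm U hUG α hα0 hαle hUη hUw hpl hUgrad j₀ hJ hj' levB
  have hw1 := topLevel_weights (ι := Bond d (towerP L m (n + 1))) (L := (L : ℝ)) hηL 1
  have hw2 := topLevel_weights (ι := Bond d (towerP L m (n + 1)) × Fin d) (L := (L : ℝ)) hηL 2
  have hw3 := topLevel_weights (ι := Bond d (towerP L m (n + 1))) (L := (L : ℝ)) hηL 3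
  have hwB := zeroExp_weights (L := (L : ℝ)) (η := η) levB
  exact HC n η hηL c₀ c₁ hw hc₀η hρ' m hm U hUG α hα0 hαle hUη hUw hpl hUgrad j₀ hJ hj' (fun _ => n + 1) (fun _ => n + 1) levB (fun _ => le_rfl)
    hw1.1 hw2.1 hw3.2 hwB hw2.2

end Summit.QuantumFields.BalabanUV.T4Continuum.NE9CurChartTowerPiLipschitzAtFlatLatticeUniformClassW80TopLevel

end
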